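import Mathlib
import HarnessLib
import Summits.NavierStokesRegularity.NavierStokesRegularity.Theorems.PoloidalWindowDoorLrcModEntireAxisKinematics8

/-!
# Route `PoloidalWindowDoor`, item `LrcModEntire` (stmt-NavierStokesRegularity-20428) — AXIS KINEMATICS IX: the second-order coefficient
# `∂_w ∂₂ W = −2(w·c′) P_r − 4 U_{c′} U_w P_rr + 2 U_w P_zr` for `W = P(ρ_c², z)` (plan step VII, part 2)

Cell ns-regularity-ideate, seat ns-poloidal-K2-p3 gen 5 (LEAD of item 20428; file landed `--supports stmt-NavierStokesRegularity-20428` as a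
helper).  With `…AxisKinematics8` (`DW[p] = 2U_p P_r`, `DW[e₂] = −2U_{c′}P_r + P_z`, `DU_{c′}[w] = w·c′`): for `P` of class `C²` at `Ψ(y)` and a
`C²` centre curve, the mixed derivative of `W(y) = P(g y, y₂)` along `e₂` then a horizontal `w` is
`−2(w₀c₀′ + w₁c₁′) P_r(Ψy) − 4 U_{c′}(y) U_w(y) P_rr(Ψy) + 2 U_w(y) P_zr(Ψy)`, `P_rr := D(P_r)(1,0)`, `P_zr := D(P_z)(1,0)`
(`rotGen`-direction `w = Jc′` kills the first term: the identity (★) of `…AxisKinematics3` becomes `αU_wU_a + βU_w + γU_{w′}` with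
`α = −8P_rr∘Ψ`, `β = 4P_zr∘Ψ`, `γ = 2P_r∘Ψ`, all `L`-invariant by `…AxisKinematics6.rotDeriv_comp_sqDistMoving`).

* `fderiv_vertical_eq_nhds` — near `y`, `y′ ↦ DW(y′)[e₂]` IS the function `−2U_{c′}·(P_r∘Ψ) + P_z∘Ψ`;
* `fderiv_horizontal_fderiv_vertical` — **the formula for `∂_w∂₂W`**.

WHAT THIS IS NOT: not a claim about Navier–Stokes regularity and not the axis lemma — calculus (bears_on LADDER-NS N0 via item 20428).
-/

noncomputable section

-- the summit and its single sub-problem share the name (CONVENTIONS §1), as in every Theorems file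
set_option linter.dupNamespace false

namespace Summit.NavierStokesRegularity.NavierStokesRegularity.Theorems.PoloidalWindowDoorLrcModEntireAxisKinematics9

open Set Function Filter Topology Metric
open scoped RealInnerProductSpace InnerProductSpace
open Literature.Analysis Literature.Analysis.FluidPDE
open Summit.NavierStokesRegularity.NavierStokesRegularity.Theorems.PoloidalWindowDoorLrcModEntireAxisKinematics6
open Summit.NavierStokesRegularity.NavierStokesRegularity.Theorems.PoloidalWindowDoorLrcModEntireAxisKinematics8

variable {c₀ c₁ : ℝ → ℝ} {P : ℝ × ℝ → ℝ}

/-- **Near `y`, the vertical derivative of `W = P(ρ_c², z)` is the function `−2U_{c′}·P_r∘Ψ + P_z∘Ψ`** (`P` differentiable near `Ψ y`,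
centre curve differentiable). -/
theorem fderiv_vertical_eq_nhds {y : EuclideanSpace ℝ (Fin 3)} (hc₀ : Differentiable ℝ c₀) (hc₁ : Differentiable ℝ c₁)
    (hP : ∀ᶠ q in 𝓝 ((y 0 - c₀ (y 2)) ^ 2 + (y 1 - c₁ (y 2)) ^ 2, y 2), DifferentiableAt ℝ P q) :
    (fun y' : EuclideanSpace ℝ (Fin 3) => fderiv ℝ (fun y'' : EuclideanSpace ℝ (Fin 3) =>
        P ((y'' 0 - c₀ (y'' 2)) ^ 2 + (y'' 1 - c₁ (y'' 2)) ^ 2, y'' 2)) y' (EuclideanSpace.single 2 1)) =ᶠ[𝓝 y]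
      fun y' => -2 * ((y' 0 - c₀ (y' 2)) * deriv c₀ (y' 2) + (y' 1 - c₁ (y' 2)) * deriv c₁ (y' 2)) *
          fderiv ℝ P ((y' 0 - c₀ (y' 2)) ^ 2 + (y' 1 - c₁ (y' 2)) ^ 2, y' 2) (1, 0) +
        fderiv ℝ P ((y' 0 - c₀ (y' 2)) ^ 2 + (y' 1 - c₁ (y' 2)) ^ 2, y' 2) (0, 1) := by
  -- `Ψ` is continuous, so `P` is differentiable at `Ψ y'` for `y'` near `y`
  have h0 : Continuous (fun y' : EuclideanSpace ℝ (Fin 3) => y' 0) :=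
    (EuclideanSpace.proj (0 : Fin 3) : EuclideanSpace ℝ (Fin 3) →L[ℝ] ℝ).continuous
  have h1 : Continuous (fun y' : EuclideanSpace ℝ (Fin 3) => y' 1) :=
    (EuclideanSpace.proj (1 : Fin 3) : EuclideanSpace ℝ (Fin 3) →L[ℝ] ℝ).continuous
  have h2 : Continuous (fun y' : EuclideanSpace ℝ (Fin 3) => y' 2) :=
    (EuclideanSpace.proj (2 : Fin 3) : EuclideanSpace ℝ (Fin 3) →L[ℝ] ℝ).continuous
  have hΨc : Continuous (fun y' : EuclideanSpace ℝ (Fin 3) => ((y' 0 - c₀ (y' 2)) ^ 2 + (y' 1 - c₁ (y' 2)) ^ 2, y' 2)) :=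
    (((h0.sub (hc₀.continuous.comp h2)).pow 2).add ((h1.sub (hc₁.continuous.comp h2)).pow 2)).prodMk h2
  have hnear : ∀ᶠ y' in 𝓝 y, DifferentiableAt ℝ P ((y' 0 - c₀ (y' 2)) ^ 2 + (y' 1 - c₁ (y' 2)) ^ 2, y' 2) :=
    (hΨc.tendsto y).eventually hP
  filter_upwards [hnear] with y' hy'
  exact fderiv_radialMoving_vertical (hc₀ _) (hc₁ _) hy'

/-- **`∂_w ∂₂ W` for `W = P(ρ_c², z)`.**  Let the centre curve be `C²`, `P` differentiable near `Ψ y` with `P_r := DP(·)(1,0)` and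
`P_z := DP(·)(0,1)` differentiable at `Ψ y`, and `w` horizontal (`w₂ = 0`).  Then
`D(y′ ↦ DW(y′)[e₂])(y)[w] = −2(w₀c₀′ + w₁c₁′)·P_r(Ψy) − 4·U_{c′}(y)·U_w(y)·P_rr(Ψy) + 2·U_w(y)·P_zr(Ψy)`,
with `U_p(y) = (y₀ − c₀)p₀ + (y₁ − c₁)p₁`, `P_rr = D P_r(Ψy)(1,0)`, `P_zr = D P_z(Ψy)(1,0)`. -/
theorem fderiv_horizontal_fderiv_vertical {y : EuclideanSpace ℝ (Fin 3)} (hc₀ : ContDiff ℝ 2 c₀) (hc₁ : ContDiff ℝ 2 c₁)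
    (hP : ∀ᶠ q in 𝓝 ((y 0 - c₀ (y 2)) ^ 2 + (y 1 - c₁ (y 2)) ^ 2, y 2), DifferentiableAt ℝ P q)
    (hPr : DifferentiableAt ℝ (fun q => fderiv ℝ P q (1, 0)) ((y 0 - c₀ (y 2)) ^ 2 + (y 1 - c₁ (y 2)) ^ 2, y 2))
    (hPz : DifferentiableAt ℝ (fun q => fderiv ℝ P q (0, 1)) ((y 0 - c₀ (y 2)) ^ 2 + (y 1 - c₁ (y 2)) ^ 2, y 2))
    {w : EuclideanSpace ℝ (Fin 3)} (hw : w 2 = 0) :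
    fderiv ℝ (fun y' : EuclideanSpace ℝ (Fin 3) => fderiv ℝ (fun y'' : EuclideanSpace ℝ (Fin 3) =>
        P ((y'' 0 - c₀ (y'' 2)) ^ 2 + (y'' 1 - c₁ (y'' 2)) ^ 2, y'' 2)) y' (EuclideanSpace.single 2 1)) y w =
      -2 * (w 0 * deriv c₀ (y 2) + w 1 * deriv c₁ (y 2)) *
            fderiv ℝ P ((y 0 - c₀ (y 2)) ^ 2 + (y 1 - c₁ (y 2)) ^ 2, y 2) (1, 0) -
          4 * ((y 0 - c₀ (y 2)) * deriv c₀ (y 2) + (y 1 - c₁ (y 2)) * deriv c₁ (y 2)) *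
            ((y 0 - c₀ (y 2)) * w 0 + (y 1 - c₁ (y 2)) * w 1) *
            fderiv ℝ (fun q => fderiv ℝ P q (1, 0)) ((y 0 - c₀ (y 2)) ^ 2 + (y 1 - c₁ (y 2)) ^ 2, y 2) (1, 0) +
        2 * ((y 0 - c₀ (y 2)) * w 0 + (y 1 - c₁ (y 2)) * w 1) *
          fderiv ℝ (fun q => fderiv ℝ P q (0, 1)) ((y 0 - c₀ (y 2)) ^ 2 + (y 1 - c₁ (y 2)) ^ 2, y 2) (1, 0) := by
  have hc₀d : Differentiable ℝ c₀ := hc₀.differentiable (by norm_num)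
  have hc₁d : Differentiable ℝ c₁ := hc₁.differentiable (by norm_num)
  have hc₀' : Differentiable ℝ (deriv c₀) := by
    have := hc₀.iterate_deriv' 1 1
    simpa using this.differentiable (by norm_num)
  have hc₁' : Differentiable ℝ (deriv c₁) := by
    have := hc₁.iterate_deriv' 1 1
    simpa using this.differentiable (by norm_num)
  -- replace the inner function by its explicit form near `y`
  rw [(fderiv_vertical_eq_nhds hc₀d hc₁d hP).fderiv_eq]
  -- the three building blocks at `y`
  set U : EuclideanSpace ℝ (Fin 3) → ℝ := fun y' => (y' 0 - c₀ (y' 2)) * deriv c₀ (y' 2) + (y' 1 - c₁ (y' 2)) * deriv c₁ (y' 2)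
    with hU
  set R : EuclideanSpace ℝ (Fin 3) → ℝ := fun y' => fderiv ℝ P ((y' 0 - c₀ (y' 2)) ^ 2 + (y' 1 - c₁ (y' 2)) ^ 2, y' 2) (1, 0)
    with hR
  set Z : EuclideanSpace ℝ (Fin 3) → ℝ := fun y' => fderiv ℝ P ((y' 0 - c₀ (y' 2)) ^ 2 + (y' 1 - c₁ (y' 2)) ^ 2, y' 2) (0, 1)
    with hZ
  have hUd : DifferentiableAt ℝ U y := by
    have h2 : DifferentiableAt ℝ (fun y' : EuclideanSpace ℝ (Fin 3) => y' 2) y :=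
      (EuclideanSpace.proj (2 : Fin 3) : EuclideanSpace ℝ (Fin 3) →L[ℝ] ℝ).differentiableAt
    have hA := (Summit.NavierStokesRegularity.NavierStokesRegularity.Theorems.PoloidalWindowDoorLrcModEntireAxisKinematics3.hasFDerivAt_coordSubFun
      (hc₀d _) 0 (y := y)).differentiableAt
    have hB := (Summit.NavierStokesRegularity.NavierStokesRegularity.Theorems.PoloidalWindowDoorLrcModEntireAxisKinematics3.hasFDerivAt_coordSubFun
      (hc₁d _) 1 (y := y)).differentiableAt
    exact (hA.mul ((hc₀' _).comp y h2)).add (hB.mul ((hc₁' _).comp y h2))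
  have hΨd : DifferentiableAt ℝ (fun y' : EuclideanSpace ℝ (Fin 3) => ((y' 0 - c₀ (y' 2)) ^ 2 + (y' 1 - c₁ (y' 2)) ^ 2, y' 2)) y :=
    ((hasFDerivAt_sqDistMoving (hc₀d _) (hc₁d _)).prodMk
      ((EuclideanSpace.proj (2 : Fin 3) : EuclideanSpace ℝ (Fin 3) →L[ℝ] ℝ).hasFDerivAt)).differentiableAt
  have hRd : DifferentiableAt ℝ R y := by rw [hR]; exact hPr.comp y hΨd
  have hZd : DifferentiableAt ℝ Z y := by rw [hZ]; exact hPz.comp y hΨd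
  have hUw : fderiv ℝ U y w = w 0 * deriv c₀ (y 2) + w 1 * deriv c₁ (y 2) :=
    fderiv_Ucprime_horizontal (hc₀d _) (hc₁d _) (hc₀' _) (hc₁' _) hw
  have hRw : fderiv ℝ R y w = 2 * ((y 0 - c₀ (y 2)) * w 0 + (y 1 - c₁ (y 2)) * w 1) *
      fderiv ℝ (fun q => fderiv ℝ P q (1, 0)) ((y 0 - c₀ (y 2)) ^ 2 + (y 1 - c₁ (y 2)) ^ 2, y 2) (1, 0) :=
    fderiv_radialMoving_horizontal (P := fun q => fderiv ℝ P q (1, 0)) (hc₀d _) (hc₁d _) hPr hw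
  have hZw : fderiv ℝ Z y w = 2 * ((y 0 - c₀ (y 2)) * w 0 + (y 1 - c₁ (y 2)) * w 1) *
      fderiv ℝ (fun q => fderiv ℝ P q (0, 1)) ((y 0 - c₀ (y 2)) ^ 2 + (y 1 - c₁ (y 2)) ^ 2, y 2) (1, 0) :=
    fderiv_radialMoving_horizontal (P := fun q => fderiv ℝ P q (0, 1)) (hc₀d _) (hc₁d _) hPz hw
  -- differentiate `−2 U R + Z`
  have hfun : (fun y' => -2 * ((y' 0 - c₀ (y' 2)) * deriv c₀ (y' 2) + (y' 1 - c₁ (y' 2)) * deriv c₁ (y' 2)) *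
        fderiv ℝ P ((y' 0 - c₀ (y' 2)) ^ 2 + (y' 1 - c₁ (y' 2)) ^ 2, y' 2) (1, 0) +
      fderiv ℝ P ((y' 0 - c₀ (y' 2)) ^ 2 + (y' 1 - c₁ (y' 2)) ^ 2, y' 2) (0, 1)) = fun y' => -2 * U y' * R y' + Z y' := by
    funext y'; simp only [hU, hR, hZ]
  have hD : HasFDerivAt (fun y' => -2 * U y' * R y' + Z y')
      (((-2 * U y) • fderiv ℝ R y + R y • ((-2 : ℝ) • fderiv ℝ U y)) + fderiv ℝ Z y) y :=
    (((hUd.hasFDerivAt.const_mul (-2 : ℝ)).mul hRd.hasFDerivAt).add hZd.hasFDerivAt)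
  rw [hfun, hD.fderiv]
  simp only [add_apply, smul_apply, smul_eq_mul, hUw, hRw, hZw]
  simp only [hU, hR]
  ring

end Summit.NavierStokesRegularity.NavierStokesRegularity.Theorems.PoloidalWindowDoorLrcModEntireAxisKinematics9

end
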